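/- Copyright: the b2b-balaban cell (near-miss cell 7), T⁴-continuum fan-out, lineage t4-ne7b-p1 (node U5c COUNT
member).  Released under the licence of the surrounding project. -/
import Literature.MathematicalPhysics.QuantumFieldTheory.Balaban1983to89.B16OverhangN

/-!
# M5-1b (J-OV) — THE OVERHANG COST OF ONE `N`-ARY JOIN IN VOLUME FORM, PER-STEP WEIGHTS, SPLIT FEE ∕ FLOOR ∕ TAIL
(owner module of row NE7b, lineage `t4-ne7b-p1` gen 43; re-open object (α), `SCOPE-alpha.md` v2.6, ruling R-OWNER-42-3
«M5-1b is a JUNCTION to the b02 lineage's index-model geometry — its POINTWISE overhang lemmas, re-packaged in the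
END's per-step currency; no new coalescence geometry in this lineage»; PRE-POSITIONING ONLY)

Summits-side support leaf of the T⁴-continuum cell (rung (B)+1 on a FINITE torus only; NOT infinite volume, NOT the
mass gap, NOT the Clay statement; NOT a proof of the spine estimate NE7b, which is the cell's OWN estimate, NOT PRINTED
and NOT PROVED).  [folklore] finite sums and real arithmetic over the b02 lineage's ℤᵈ index model of the operation `S`
(`Balaban1983to89.B16SProfile`: `Siter`, `Sop`, `ratio`, `DropCtl`) and its `N`-ary overhang bookkeeping
`Balaban1983to89.B16OverhangN` — REUSED BY NAME: `overhangN`, `card_Siter_le_alive_add_overhangN` (the live∕dead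
decomposition), `overhangN_le_card` (FEE side: `o_i ≤ 561^d·|S|`), `overhangN_le_decay` (DECAY side: `o_i ≤
1122^d·(16·treeLen S(Z)∕2^i + 1)`), `faceConnected_Sop_of_touchConnected`, `treeLen_Sop_biUnion_le`,
`sum_Ioc_inv_two_pow_le`; nothing printed is asserted, no `def … : Prop` fact of Bałaban's is minted, no cite-tagged
hypothesis, zero `sorry`, NO `def` (no notion is introduced).  B16 = [Balaban1989LargeFieldII] pp. 386–387 (1.85)–(1.88)
under audit; locators only.

WHY (ruling R-OWNER-42-3, journal «RULING R-OWNER-42-3», this gen; R-OWNER-42-2 «M5's cost side in TOTAL form»).  The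
END consumes the H3 cost binder only as `lifeCost (padW …) (κ K q) q.2 ≤ lifeCost (padW …) (costT …) q.2`
(`HistoryRealiseCellsRunApexT3bWT.CountRoadWitnessT3bWT.cost_le`, IR-42-2).  M5-1 reads the realised volume cost of a
live structure — `Σ_m u_m · #(domain at m)` summed over its components (M2-B's `Λ K m ^ #c.2`, `u_m = log Λ K m`) — below
the booked `costT`.  Along a structure's pedigree the domain of a component formed by a JOIN at scale `s` of pieces
`x ∈ S` (old components' current images `B_x` and new regions) lies inside `Z = ⋃_x B_x` ((G-join)), and `i` steps later
inside `S^i(Z)`; b02's live∕dead decomposition reads `#S^i(Z) ≤ Σ_{x alive at i} #S^i(B_x) + o_i`, where a piece is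
ALIVE while its own (hypothetical, un-merged) orbit has not yet met condition (i) (its death step `a_x`; the alive part
is paid by the pieces' OWN budgets, inductively) and the DEAD OVERHANG `o_i` is what coalescence must pay.  b02's
`StepInhabitedMergeIndex.controlsAm_merge_index` packages the overhang as ONE fee per merger charged to the printed
exponent gain `2(1+β₀)⁻¹p₀(g_{j+1})`, with a term `1122^d·(N+k)` proportional to the merged HORIZON; in the END's
booking that gain is the merger event's window floors PLACED AT THE LATER PARTNER REACH — possibly beyond the cutoff
`K`, where `floorK = 0` (steps not performed book nothing) — so the verbatim junction does not discharge.  The END pays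
horizon-proportional costs PER STEP instead (every performed step of a pending life is covered by some event's window,
`T4PersistenceDictionary.Gen.covers`).  THIS FILE therefore re-packages b02's POINTWISE lemmas in per-step weighted
form: for nonnegative per-step weights `u_i` on the merged horizon `0 < i ≤ k` (relative indices, time `0` = the join
scale), §1 the weighted live∕dead decomposition and the formation level (`o_0 = 0`; a realised join domain `E ⊆ Z`
costs at most `Σ_x #B_x` at the join scale); §2 **`weighted_sum_overhangN_le`**: `Σ_{0<i≤k} u_i·o_i ≤ 561^d·|S|·Σ_{0<i≤
min(j′,k)} u_i` (FEE: per piece, for the first `j′` steps — to be paid by the merger events' connector size cost `sz`,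
`wt = dC`) `+ 1122^d·Σ_{j′<i≤k} u_i` (FLOOR: one unit per performed step of the merged horizon — to be paid by the
covering window) `+ 1122^d·16·treeLen S(Z)·Σ_{j′<i≤k} u_i∕2^i` (TAIL: coefficient as small as desired in `j′` — to be
paid by the reserve `θ` on the pieces' join-scale volumes, `treeLen S(Z) + 1 ≤ 21^d·Σ_x #B_x`), with the uniform-weight
corollary `… ≤ U·1122^d·16·treeLen S(Z)∕2^{j′}` (§2b); §3 **`join_weightedVolume_le`**: the END-TO-END inequality of ONE
join over its horizon for any realised domain `E ⊆ Z`; §4 the exchange of summation that ATTRIBUTES the alive part to the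
pieces (`Σ_i u_i Σ_{x alive at i} #S^i(B_x) = Σ_x Σ_{0<i≤min(a_x,k)} u_i #S^i(B_x)` — each piece pays its own continuation
through its own death step: the inductive hypothesis of the ledger M5-1b (J-LEDGER)); §5 sanity (no overhang while every
piece is alive; the displays are not vacuous).

WHAT IS *NOT* DONE HERE.  The LEDGER (J-LEDGER: the telescoping of extended∕actual lone costs over a structure's
components, births∕renewals∕join clusters, with the reserve `θ`), the instantiation over the lineage's realised pedigrees
(`RealisesW`, pass-V objects: death steps from `Stops`, the horizon–size link `B16OverhangN.two_pow_find_sub_le₁`, join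
clusters = print's `N`-ary mergers per level), and the comparison with `costT`'s tables (births: M5-1a
`HistoryBankingVolumeProfile.sum_unitCost_card_Siter_le_booked`; renewals: the small-box bound
`B16OverhangN.Siter_subset_box_of_condI` against the renewal window; joins: THIS FILE against the merger events' `sz`
(connector class `dC`, a LOCATED largeness — finding F-OWNER-43-1) and the covering floors).  HONEST: index-model
bookkeeping of the b02 lineage re-weighted; NE7b NOT proved; spine 0∕9.  HONEST DEPENDENCY (cell): continuum YM on T⁴ ⇐
BetaPertH ∧ nine spine estimates (0∕9 proved); BetaPertH ⇐ (D1) ∧ (D4) ∧ CAP+tail.  This file changes none of it.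
-/

open Finset
open Literature.MathematicalPhysics.QuantumFieldTheory.Balaban1983to89
open Literature.MathematicalPhysics.QuantumFieldTheory.Balaban1983to89.B13ScaleTransfer
open Literature.MathematicalPhysics.QuantumFieldTheory.Balaban1983to89.TreeLength
open Literature.MathematicalPhysics.QuantumFieldTheory.Balaban1983to89.B16SProfile
open Literature.MathematicalPhysics.QuantumFieldTheory.Balaban1983to89.B16MergeGeometry
open Literature.MathematicalPhysics.QuantumFieldTheory.Balaban1983to89.B16StoppingRule
open Literature.MathematicalPhysics.QuantumFieldTheory.Balaban1983to89.B16MergeHorizon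
open Literature.MathematicalPhysics.QuantumFieldTheory.Balaban1983to89.B16OverhangN

namespace Summit.QuantumFields.BalabanUV.T4Continuum.HistoryBankingOverhangCost

noncomputable section

variable {d : ℕ} {ι : Type*}

/-! ## §1 The weighted live∕dead decomposition of one step, and the formation level -/

/-- **THE WEIGHTED LIVE∕DEAD DECOMPOSITION AT ONE STEP**: for a nonnegative weight `w`,
`w·#S^i(Z) ≤ w·Σ_{x alive at i} #S^i(B_x) + w·o_i` (`Z = ⋃_{x∈S} B_x`; b02's `card_Siter_le_alive_add_overhangN`).
[folklore] -/
theorem weighted_card_Siter_biUnion_le (q : ℕ → ℕ) (S : Finset ι) (B : ι → Finset (Pt d)) (a : ι → ℕ) (i : ℕ)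
    {w : ℝ} (hw : 0 ≤ w) :
    w * ((Siter q i (S.biUnion B)).card : ℝ) ≤
      w * (∑ x ∈ S.filter (fun x => i ≤ a x), ((Siter q i (B x)).card : ℝ)) + w * (overhangN q S B a i : ℝ) := by
  rw [← mul_add]
  refine mul_le_mul_of_nonneg_left ?_ hw
  exact_mod_cast card_Siter_le_alive_add_overhangN q S B a i

/-- **A REALISED JOIN DOMAIN COSTS AT MOST THE UNION OF ITS CONSTITUENTS' IMAGES**, at every later step: `E ⊆ Z` gives
`w·#S^i(E) ≤ w·#S^i(Z)` (`Siter` is monotone). [folklore] -/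
theorem weighted_card_Siter_le_of_subset (q : ℕ → ℕ) {E Z : Finset (Pt d)} (hE : E ⊆ Z) (i : ℕ) {w : ℝ}
    (hw : 0 ≤ w) : w * ((Siter q i E).card : ℝ) ≤ w * ((Siter q i Z).card : ℝ) := by
  refine mul_le_mul_of_nonneg_left ?_ hw
  exact_mod_cast Finset.card_le_card (Siter_subset_Siter q hE i)

/-- **NO OVERHANG AT THE JOIN SCALE**: every piece is alive at relative step `0`, so `o_0 = 0`. [folklore] -/
theorem overhangN_zero (q : ℕ → ℕ) (S : Finset ι) (B : ι → Finset (Pt d)) (a : ι → ℕ) :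
    overhangN q S B a 0 = 0 := by
  unfold overhangN
  have h : S.filter (fun x => 0 ≤ a x) = S := Finset.filter_true_of_mem fun x _ => Nat.zero_le _
  rw [h]
  exact Nat.sub_self _

/-- **THE FORMATION LEVEL**: a realised join domain `E ⊆ ⋃_x B_x` costs at most the sum of the constituents' volumes at
the join scale, `w·#E ≤ w·Σ_x #B_x` (cube currency is sub-additive for free — b02's `hc_index`). [folklore] -/
theorem formation_weightedVolume_le (S : Finset ι) (B : ι → Finset (Pt d)) {E : Finset (Pt d)}
    (hE : E ⊆ S.biUnion B) {w : ℝ} (hw : 0 ≤ w) :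
    w * (E.card : ℝ) ≤ w * ∑ x ∈ S, ((B x).card : ℝ) := by
  refine mul_le_mul_of_nonneg_left ?_ hw
  have h1 : E.card ≤ (S.biUnion B).card := Finset.card_le_card hE
  have h2 : (S.biUnion B).card ≤ ∑ x ∈ S, (B x).card := Finset.card_biUnion_le
  exact_mod_cast h1.trans h2

/-! ## §2 The weighted overhang sum over a horizon, split at `j′`: FEE ∕ FLOOR ∕ TAIL -/

section Horizon

variable {L : ℕ} {σ : ℕ → ℕ} {m' : ℕ} {S : Finset ι} {B : ι → Finset (Pt d)} {b : ι → Pt d} {a : ι → ℕ}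

/-- the two index filters of the split, as intervals [folklore] -/
theorem filter_le_Ioc_eq (k jf : ℕ) : (Finset.Ioc 0 k).filter (fun i => i ≤ jf) = Finset.Ioc 0 (min jf k) := by
  ext i
  simp only [Finset.mem_filter, Finset.mem_Ioc]
  omega

/-- the complementary filter [folklore] -/
theorem filter_not_le_Ioc_eq (k jf : ℕ) : (Finset.Ioc 0 k).filter (fun i => ¬ i ≤ jf) = Finset.Ioc jf k := by
  ext i
  simp only [Finset.mem_filter, Finset.mem_Ioc]
  omega

/-- **THE WEIGHTED OVERHANG SUM OF ONE `N`-ARY JOIN, SPLIT AT `j′`.**  Pieces `B_x` (`x ∈ S`, `S ≠ ∅`) with chosen cubes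
`b x ∈ B_x` and death steps `a_x`, those dying before the horizon `k` meeting condition (i) when they die (`hI`), merged
body `Z = ⋃ B_x` TOUCH-connected (the graph `G` of p. 386), the flow `ratio L σ` with `L ≥ 4` and drop control on
`[0, m′] ∋ k`; nonnegative per-step weights `u`.  Then for EVERY `j′`:
`Σ_{0<i≤k} u_i·o_i ≤ 561^d·|S|·Σ_{0<i≤min(j′,k)} u_i + 1122^d·Σ_{j′<i≤k} u_i + 1122^d·16·treeLen S(Z)·Σ_{j′<i≤k} u_i∕2^i`
— FEE (per piece, first `j′` steps), FLOOR (one unit per later step), TAIL (decaying).  From b02's `overhangN_le_card` ∕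
`overhangN_le_decay` termwise. [folklore] -/
theorem weighted_sum_overhangN_le (hL : 4 ≤ L) (hσ : DropCtl σ m') (hb : ∀ x ∈ S, b x ∈ B x) (hS : S.Nonempty)
    (hZc : TouchConnected (S.biUnion B)) {k : ℕ} (hk : k ≤ m')
    (hI : ∀ x ∈ S, a x < k → CondI 100 (Siter (ratio L σ) (a x) (B x))) {u : ℕ → ℝ} (hu : ∀ i, 0 ≤ u i)
    (jf : ℕ) :
    ∑ i ∈ Finset.Ioc 0 k, u i * (overhangN (ratio L σ) S B a i : ℝ) ≤
      561 ^ d * S.card * (∑ i ∈ Finset.Ioc 0 (min jf k), u i)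
        + 1122 ^ d * (∑ i ∈ Finset.Ioc jf k, u i)
        + 1122 ^ d * 16 * treeLen (Sop (ratio L σ 0) (S.biUnion B)) * (∑ i ∈ Finset.Ioc jf k, u i / 2 ^ i) := by
  have hq0 : 0 < ratio L σ 0 := ratio_pos (by omega) σ 0
  have hZ₁c := faceConnected_Sop_of_touchConnected hq0 hZc
  set T₁ := treeLen (Sop (ratio L σ 0) (S.biUnion B)) with hT₁
  let f : ℕ → ℝ := fun i => if i ≤ jf then u i * ((561 : ℝ) ^ d * S.card) else u i * (1122 ^ d * (16 * T₁ / 2 ^ i + 1))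
  have hterm : ∀ i ∈ Finset.Ioc 0 k, u i * (overhangN (ratio L σ) S B a i : ℝ) ≤ f i := by
    intro i hi
    rw [Finset.mem_Ioc] at hi
    have hIi : ∀ x ∈ S, a x < i → CondI 100 (Siter (ratio L σ) (a x) (B x)) :=
      fun x hx hax => hI x hx (by omega)
    by_cases hij : i ≤ jf
    · simp only [f, if_pos hij]
      refine mul_le_mul_of_nonneg_left ?_ (hu i)
      exact_mod_cast overhangN_le_card (by omega) hσ hb hIi (by omega : i ≤ m')
    · simp only [f, if_neg hij]
      refine mul_le_mul_of_nonneg_left ?_ (hu i)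
      exact overhangN_le_decay hL hσ hb hIi hS hZ₁c (by omega) (by omega)
  have hsplit : ∑ i ∈ Finset.Ioc 0 k, f i =
      (∑ i ∈ (Finset.Ioc 0 k).filter (fun i => i ≤ jf), u i * ((561 : ℝ) ^ d * S.card)) +
        ∑ i ∈ (Finset.Ioc 0 k).filter (fun i => ¬ i ≤ jf), u i * (1122 ^ d * (16 * T₁ / 2 ^ i + 1)) :=
    Finset.sum_ite _ _
  rw [filter_le_Ioc_eq, filter_not_le_Ioc_eq] at hsplit
  have hfee : ∑ i ∈ Finset.Ioc 0 (min jf k), u i * ((561 : ℝ) ^ d * S.card) =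
      561 ^ d * S.card * ∑ i ∈ Finset.Ioc 0 (min jf k), u i := by
    rw [Finset.mul_sum]
    exact Finset.sum_congr rfl fun i _ => by ring
  have htail : ∑ i ∈ Finset.Ioc jf k, u i * ((1122 : ℝ) ^ d * (16 * T₁ / 2 ^ i + 1)) =
      1122 ^ d * (∑ i ∈ Finset.Ioc jf k, u i) + 1122 ^ d * 16 * T₁ * ∑ i ∈ Finset.Ioc jf k, u i / 2 ^ i := by
    rw [Finset.mul_sum, Finset.mul_sum, ← Finset.sum_add_distrib]
    refine Finset.sum_congr rfl fun i _ => ?_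
    field_simp
    ring
  calc ∑ i ∈ Finset.Ioc 0 k, u i * (overhangN (ratio L σ) S B a i : ℝ)
      ≤ ∑ i ∈ Finset.Ioc 0 k, f i := Finset.sum_le_sum hterm
    _ = _ := by rw [hsplit, hfee, htail]; ring

/-- **SIZE CONVERSION FOR THE TAIL**: `treeLen S(Z) ≤ 21^d·Σ_x #B_x − 1 ≤ 21^d·Σ_x #B_x` (b02's
`treeLen_Sop_biUnion_le`, touch-connected `Z`, `L ≥ 1`). [folklore] -/
theorem treeLen_Sop_le_pieces (hL : 1 ≤ L) (σ : ℕ → ℕ) (hb : ∀ x ∈ S, b x ∈ B x) (hS : S.Nonempty)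
    (hZc : TouchConnected (S.biUnion B)) :
    treeLen (Sop (ratio L σ 0) (S.biUnion B)) + 1 ≤ 21 ^ d * ∑ x ∈ S, ((B x).card : ℝ) := by
  have hq0 : 0 < ratio L σ 0 := ratio_pos (by omega) σ 0
  have hZ : (S.biUnion B).Nonempty := by
    obtain ⟨x, hx⟩ := hS
    exact ⟨b x, Finset.mem_biUnion.2 ⟨x, hx, hb x hx⟩⟩
  exact treeLen_Sop_biUnion_le (ratio L σ 0) hZ (faceConnected_Sop_of_touchConnected hq0 hZc)

/-- **THE TAIL UNDER A UNIFORM WEIGHT BOUND**: if `u_i ≤ U` on `j′ < i ≤ k` then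
`Σ_{j′<i≤k} u_i∕2^i ≤ U∕2^{j′}` (b02's geometric tail `sum_Ioc_inv_two_pow_le`). [folklore] -/
theorem sum_weight_div_two_pow_le {u : ℕ → ℝ} {U : ℝ} {jf k : ℕ} (hU0 : 0 ≤ U)
    (hU : ∀ i ∈ Finset.Ioc jf k, u i ≤ U) :
    ∑ i ∈ Finset.Ioc jf k, u i / 2 ^ i ≤ U / 2 ^ jf := by
  calc ∑ i ∈ Finset.Ioc jf k, u i / 2 ^ i ≤ ∑ i ∈ Finset.Ioc jf k, U * ((1 : ℝ) / 2 ^ i) := by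
        refine Finset.sum_le_sum fun i hi => ?_
        rw [mul_one_div]
        exact div_le_div_of_nonneg_right (hU i hi) (by positivity)
    _ = U * ∑ i ∈ Finset.Ioc jf k, (1 : ℝ) / 2 ^ i := by rw [Finset.mul_sum]
    _ ≤ U * (1 / 2 ^ jf) := mul_le_mul_of_nonneg_left (sum_Ioc_inv_two_pow_le jf k) hU0
    _ = U / 2 ^ jf := mul_one_div U _

/-- **THE WEIGHTED OVERHANG SUM WITH THE TAIL IN PIECE VOLUMES**: under a uniform bound `u_i ≤ U` beyond `j′`, the tail is
at most `U·1122^d·16·21^d·(Σ_x #B_x)∕2^{j′}` — a multiple, AS SMALL AS DESIRED in `j′`, of the constituents' join-scale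
volumes (what the reserve `θ` on the pieces' join-scale costs pays in the ledger). [folklore] -/
theorem weighted_sum_overhangN_le_uniform (hL : 4 ≤ L) (hσ : DropCtl σ m') (hb : ∀ x ∈ S, b x ∈ B x)
    (hS : S.Nonempty) (hZc : TouchConnected (S.biUnion B)) {k : ℕ} (hk : k ≤ m')
    (hI : ∀ x ∈ S, a x < k → CondI 100 (Siter (ratio L σ) (a x) (B x))) {u : ℕ → ℝ} (hu : ∀ i, 0 ≤ u i)
    (jf : ℕ) {U : ℝ} (hU0 : 0 ≤ U) (hU : ∀ i ∈ Finset.Ioc jf k, u i ≤ U) :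
    ∑ i ∈ Finset.Ioc 0 k, u i * (overhangN (ratio L σ) S B a i : ℝ) ≤
      561 ^ d * S.card * (∑ i ∈ Finset.Ioc 0 (min jf k), u i)
        + 1122 ^ d * (∑ i ∈ Finset.Ioc jf k, u i)
        + U * (1122 ^ d * 16 * 21 ^ d) / 2 ^ jf * ∑ x ∈ S, ((B x).card : ℝ) := by
  have h1 := weighted_sum_overhangN_le hL hσ hb hS hZc hk hI hu jf
  have h2 := sum_weight_div_two_pow_le hU0 hU (u := u) (k := k)
  have h3 := treeLen_Sop_le_pieces (show 1 ≤ L by omega) σ hb hS hZc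
  set T₁ := treeLen (Sop (ratio L σ 0) (S.biUnion B)) with hT₁
  set V := ∑ x ∈ S, ((B x).card : ℝ) with hV
  have hT0 : 0 ≤ T₁ := treeLen_nonneg _
  have hC : (0 : ℝ) ≤ 1122 ^ d * 16 * T₁ := by positivity
  have h4 : (1122 : ℝ) ^ d * 16 * T₁ * (∑ i ∈ Finset.Ioc jf k, u i / 2 ^ i) ≤ 1122 ^ d * 16 * T₁ * (U / 2 ^ jf) :=
    mul_le_mul_of_nonneg_left h2 hC
  have hT1 : T₁ ≤ 21 ^ d * V := by linarith
  have h5 : (1122 : ℝ) ^ d * 16 * T₁ * (U / 2 ^ jf) ≤ 1122 ^ d * 16 * (21 ^ d * V) * (U / 2 ^ jf) := by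
    have hU' : 0 ≤ U / 2 ^ jf := by positivity
    have : (1122 : ℝ) ^ d * 16 * T₁ ≤ 1122 ^ d * 16 * (21 ^ d * V) :=
      mul_le_mul_of_nonneg_left hT1 (by positivity)
    exact mul_le_mul_of_nonneg_right this hU'
  have h6 : (1122 : ℝ) ^ d * 16 * (21 ^ d * V) * (U / 2 ^ jf) = U * (1122 ^ d * 16 * 21 ^ d) / 2 ^ jf * V := by
    ring
  linarith

end Horizon

/-! ## §3 The end-to-end inequality of ONE join over its horizon -/

section Join

variable {L : ℕ} {σ : ℕ → ℕ} {m' : ℕ} {S : Finset ι} {B : ι → Finset (Pt d)} {b : ι → Pt d} {a : ι → ℕ}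

/-- **THE WEIGHTED VOLUME COST OF ONE JOIN OVER ITS HORIZON.**  A component formed at (relative) scale `0` by joining
the pieces `x ∈ S` with join-scale images `B_x`, its realised domain `E ⊆ ⋃_x B_x` ((G-join)), carried alone `k`
steps along the flow `ratio L σ` (`L ≥ 4`, drop control on `[0, m′] ∋ k`), `Z = ⋃ B_x` touch-connected ((G-touch)),
chosen cubes `b x ∈ B_x`, death steps `a_x` with (i) at death before `k` (`hI`), nonnegative per-step weights `u`, any
split `j′`:
`Σ_{0<i≤k} u_i·#S^i(E) ≤ Σ_{0<i≤k} u_i·Σ_{x alive at i} #S^i(B_x) + FEE + FLOOR + TAIL`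
with the three terms of `weighted_sum_overhangN_le`.  The alive part is the pieces' own continuation (§4 attributes it);
the rest is what the join itself must pay. [folklore] -/
theorem join_weightedVolume_le (hL : 4 ≤ L) (hσ : DropCtl σ m') (hb : ∀ x ∈ S, b x ∈ B x) (hS : S.Nonempty)
    (hZc : TouchConnected (S.biUnion B)) {E : Finset (Pt d)} (hE : E ⊆ S.biUnion B) {k : ℕ} (hk : k ≤ m')
    (hI : ∀ x ∈ S, a x < k → CondI 100 (Siter (ratio L σ) (a x) (B x))) {u : ℕ → ℝ} (hu : ∀ i, 0 ≤ u i)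
    (jf : ℕ) :
    ∑ i ∈ Finset.Ioc 0 k, u i * ((Siter (ratio L σ) i E).card : ℝ) ≤
      (∑ i ∈ Finset.Ioc 0 k, u i * ∑ x ∈ S.filter (fun x => i ≤ a x), ((Siter (ratio L σ) i (B x)).card : ℝ))
        + 561 ^ d * S.card * (∑ i ∈ Finset.Ioc 0 (min jf k), u i)
        + 1122 ^ d * (∑ i ∈ Finset.Ioc jf k, u i)
        + 1122 ^ d * 16 * treeLen (Sop (ratio L σ 0) (S.biUnion B)) * (∑ i ∈ Finset.Ioc jf k, u i / 2 ^ i) := by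
  have h1 : ∑ i ∈ Finset.Ioc 0 k, u i * ((Siter (ratio L σ) i E).card : ℝ) ≤
      ∑ i ∈ Finset.Ioc 0 k, (u i * (∑ x ∈ S.filter (fun x => i ≤ a x), ((Siter (ratio L σ) i (B x)).card : ℝ)) +
        u i * (overhangN (ratio L σ) S B a i : ℝ)) :=
    Finset.sum_le_sum fun i _ =>
      (weighted_card_Siter_le_of_subset _ hE i (hu i)).trans (weighted_card_Siter_biUnion_le _ S B a i (hu i))
  rw [Finset.sum_add_distrib] at h1
  have h2 := weighted_sum_overhangN_le hL hσ hb hS hZc hk hI hu jf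
  linarith

/-- **THE SAME WITH THE TAIL IN PIECE VOLUMES** (uniform weight bound `u_i ≤ U` beyond `j′`). [folklore] -/
theorem join_weightedVolume_le_uniform (hL : 4 ≤ L) (hσ : DropCtl σ m') (hb : ∀ x ∈ S, b x ∈ B x)
    (hS : S.Nonempty) (hZc : TouchConnected (S.biUnion B)) {E : Finset (Pt d)} (hE : E ⊆ S.biUnion B) {k : ℕ}
    (hk : k ≤ m') (hI : ∀ x ∈ S, a x < k → CondI 100 (Siter (ratio L σ) (a x) (B x))) {u : ℕ → ℝ}
    (hu : ∀ i, 0 ≤ u i) (jf : ℕ) {U : ℝ} (hU0 : 0 ≤ U) (hU : ∀ i ∈ Finset.Ioc jf k, u i ≤ U) :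
    ∑ i ∈ Finset.Ioc 0 k, u i * ((Siter (ratio L σ) i E).card : ℝ) ≤
      (∑ i ∈ Finset.Ioc 0 k, u i * ∑ x ∈ S.filter (fun x => i ≤ a x), ((Siter (ratio L σ) i (B x)).card : ℝ))
        + 561 ^ d * S.card * (∑ i ∈ Finset.Ioc 0 (min jf k), u i)
        + 1122 ^ d * (∑ i ∈ Finset.Ioc jf k, u i)
        + U * (1122 ^ d * 16 * 21 ^ d) / 2 ^ jf * ∑ x ∈ S, ((B x).card : ℝ) := by
  have h1 : ∑ i ∈ Finset.Ioc 0 k, u i * ((Siter (ratio L σ) i E).card : ℝ) ≤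
      ∑ i ∈ Finset.Ioc 0 k, (u i * (∑ x ∈ S.filter (fun x => i ≤ a x), ((Siter (ratio L σ) i (B x)).card : ℝ)) +
        u i * (overhangN (ratio L σ) S B a i : ℝ)) :=
    Finset.sum_le_sum fun i _ =>
      (weighted_card_Siter_le_of_subset _ hE i (hu i)).trans (weighted_card_Siter_biUnion_le _ S B a i (hu i))
  rw [Finset.sum_add_distrib] at h1
  have h2 := weighted_sum_overhangN_le_uniform hL hσ hb hS hZc hk hI hu jf hU0 hU
  linarith

end Join

/-! ## §4 Attribution of the alive part to the pieces -/

/-- **EACH PIECE PAYS ITS OWN CONTINUATION THROUGH ITS OWN DEATH STEP**: exchanging the sums,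
`Σ_{0<i≤k} u_i·Σ_{x∈S, i≤a_x} c x i = Σ_{x∈S} Σ_{0<i≤min(a_x,k)} u_i·c x i` — the form in which the ledger's inductive
hypothesis (a piece's budget controls its OWN orbit until its own readiness) enters a join. [folklore] -/
theorem sum_alive_comm (S : Finset ι) (a : ι → ℕ) (k : ℕ) (u : ℕ → ℝ) (c : ι → ℕ → ℝ) :
    (∑ i ∈ Finset.Ioc 0 k, u i * ∑ x ∈ S.filter (fun x => i ≤ a x), c x i) =
      ∑ x ∈ S, ∑ i ∈ Finset.Ioc 0 (min (a x) k), u i * c x i := by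
  have h1 : ∀ i ∈ Finset.Ioc 0 k, u i * (∑ x ∈ S.filter (fun x => i ≤ a x), c x i) =
      ∑ x ∈ S, if i ≤ a x then u i * c x i else 0 := by
    intro i _
    rw [Finset.mul_sum, Finset.sum_filter]
  rw [Finset.sum_congr rfl h1, Finset.sum_comm]
  refine Finset.sum_congr rfl fun x _ => ?_
  rw [← Finset.sum_filter]
  refine Finset.sum_congr ?_ fun _ _ => rfl
  ext i
  simp only [Finset.mem_filter, Finset.mem_Ioc]
  omega

/-- **THE ATTRIBUTED FORM OF THE JOIN INEQUALITY** (tail in piece volumes): realised weighted volume over the horizon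
`≤ Σ_x (x's own weighted continuation through min(a_x, k)) + FEE + FLOOR + (U·1122^d·16·21^d∕2^{j′})·Σ_x #B_x`.
[folklore] -/
theorem join_weightedVolume_le_attributed {L : ℕ} {σ : ℕ → ℕ} {m' : ℕ} {S : Finset ι} {B : ι → Finset (Pt d)}
    {b : ι → Pt d} {a : ι → ℕ} (hL : 4 ≤ L) (hσ : DropCtl σ m') (hb : ∀ x ∈ S, b x ∈ B x) (hS : S.Nonempty)
    (hZc : TouchConnected (S.biUnion B)) {E : Finset (Pt d)} (hE : E ⊆ S.biUnion B) {k : ℕ} (hk : k ≤ m')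
    (hI : ∀ x ∈ S, a x < k → CondI 100 (Siter (ratio L σ) (a x) (B x))) {u : ℕ → ℝ} (hu : ∀ i, 0 ≤ u i)
    (jf : ℕ) {U : ℝ} (hU0 : 0 ≤ U) (hU : ∀ i ∈ Finset.Ioc jf k, u i ≤ U) :
    ∑ i ∈ Finset.Ioc 0 k, u i * ((Siter (ratio L σ) i E).card : ℝ) ≤
      (∑ x ∈ S, ∑ i ∈ Finset.Ioc 0 (min (a x) k), u i * ((Siter (ratio L σ) i (B x)).card : ℝ))
        + 561 ^ d * S.card * (∑ i ∈ Finset.Ioc 0 (min jf k), u i)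
        + 1122 ^ d * (∑ i ∈ Finset.Ioc jf k, u i)
        + U * (1122 ^ d * 16 * 21 ^ d) / 2 ^ jf * ∑ x ∈ S, ((B x).card : ℝ) := by
  rw [← sum_alive_comm S a k u (fun x i => ((Siter (ratio L σ) i (B x)).card : ℝ))]
  exact join_weightedVolume_le_uniform hL hσ hb hS hZc hE hk hI hu jf hU0 hU

/-! ## §5 Sanity: no overhang while every piece is alive; the decomposition is not vacuous -/

/-- While every piece is alive (`i ≤ a_x` for all `x ∈ S`) there is no overhang: `o_i = 0`. [folklore] -/
theorem overhangN_eq_zero_of_all_alive (q : ℕ → ℕ) (S : Finset ι) (B : ι → Finset (Pt d)) (a : ι → ℕ) {i : ℕ}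
    (h : ∀ x ∈ S, i ≤ a x) : overhangN q S B a i = 0 := by
  unfold overhangN
  rw [Finset.filter_true_of_mem h, Nat.sub_self]

/-- A one-piece "join" (`S = {x}`, the piece alive through the horizon) realises the decomposition with equality and no
overhang — the displays of `join_weightedVolume_le` are jointly satisfiable, non-trivially (`d = 1`, one cube).
[folklore] -/
theorem sanity_singleton (q : ℕ → ℕ) (i : ℕ) :
    overhangN q ({(0 : ℕ)} : Finset ℕ) (fun _ => ({fun _ => (0 : ℤ)} : Finset (Pt 1))) (fun _ => i) i = 0 :=
  overhangN_eq_zero_of_all_alive q _ _ _ fun _ _ => le_rfl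

end

end Summit.QuantumFields.BalabanUV.T4Continuum.HistoryBankingOverhangCost
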